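import Mathlib.FieldTheory.PrimitiveElement
import Mathlib.FieldTheory.AlgebraicClosure
import Mathlib.FieldTheory.IsAlgClosed.AlgebraicClosure
import Mathlib.RingTheory.Polynomial.IsIntegral
import Mathlib.RingTheory.PolynomialAlgebra
import Mathlib.RingTheory.TensorProduct.Quotient
import Mathlib.RingTheory.TensorProduct.MvPolynomial
import Mathlib.RingTheory.AdjoinRoot
import Literature.FieldTheory.Regular.AlgClosedTensorDomain
import HarnessLib

/-!
# Regular extensions: `K ⊗ₗ M` is a domain when `L` is algebraically closed in `K`

Let `L ⊆ K` be fields of characteristic `0` with `L` *relatively algebraically closed* in `K`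
(every element of `K` algebraic over `L` lies in `L`); in characteristic `0` this says exactly
that `K/L` is a **regular** extension (Lang, *Algebra*, VIII §4). Then for every field extension
`M` of `L` the ring `K ⊗ₗ M` is an integral domain
(`Literature.FieldTheory.Regular.isDomain_tensorProduct_of_isAlgClosedIn`; Lang VIII §4,
Thm 4.12 with Cor. 4.14; Bourbaki, *Algèbre* V §17). Consequently the prime ideal of a point
`β ∈ Kⁿ` over `L` stays prime after any extension of scalars `σ : L → F'`
(`Literature.FieldTheory.Regular.isPrime_map_ker_aeval`): the locus of `β` over `L` is
absolutely irreducible — the form used for loci of good bases in the Bays–Kirby theory of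
exponential fields (`Literature/NumberTheory/Transcendental`).

## Proof

* `Literature.FieldTheory.Regular.irreducible_map_of_isAlgClosedIn`: an irreducible polynomial
  over `L` stays irreducible over `K` (the coefficients of a monic factor are integral over `L`).
* `Literature.FieldTheory.Regular.isDomain_tensorProduct_adjoinRoot`:
  `K ⊗ₗ L[X]/(h) ≅ K[X]/(h)`, a domain when `h` stays prime.
* `Literature.FieldTheory.Regular.isDomain_tensorProduct_of_isAlgebraic`: hence `K ⊗ₗ E` is a
  domain for `E/L` algebraic (finite subextensions are simple in characteristic `0`).
* For arbitrary `M`: embed `M` in an algebraic closure `M̄`, let `L̄` be the algebraic closure of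
  `L` in `M̄`; then `K ⊗ₗ M̄ ≅ (K ⊗ₗ L̄) ⊗_{L̄} M̄` with `K ⊗ₗ L̄` a domain, and over the
  algebraically closed `L̄` tensor products of domains are domains
  (`Literature.FieldTheory.Regular.isDomain_tensorProduct_of_isAlgClosed`).

## References

* S. Lang, *Algebra*, 3rd ed., GTM 211, Springer 2002, VIII §4.
* N. Bourbaki, *Algèbre*, Ch. V §17 (extensions régulières).
-/

open scoped TensorProduct Polynomial

namespace Literature.FieldTheory.Regular

/-! ### Irreducible polynomials stay irreducible -/

/-- If `L` is relatively algebraically closed in `K`, a monic irreducible polynomial over `L`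
stays irreducible over `K`: the coefficients of a monic factor over `K` are integral over `L`
(Mathlib's `Polynomial.isIntegral_coeff_of_dvd`), hence lie in `L`, so the factorisation
descends to `L`. [cite: Lang2002, VIII §4] -/
theorem irreducible_map_of_isAlgClosedIn {L K : Type*} [Field L] [Field K] [Algebra L K]
    (hrac : ∀ z : K, IsAlgebraic L z → z ∈ Set.range (algebraMap L K)) {h : L[X]} (hm : h.Monic)
    (hirr : Irreducible h) : Irreducible (h.map (algebraMap L K)) := by
  have hmK : (h.map (algebraMap L K)).Monic := hm.map _
  rw [hmK.irreducible_iff_natDegree]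
  refine ⟨fun h1 => ?_, fun f g hf hg hfg => ?_⟩
  · have h1' := congrArg Polynomial.natDegree h1
    rw [hm.natDegree_map, Polynomial.natDegree_one] at h1'
    have hpos := Polynomial.degree_pos_of_irreducible hirr
    rw [Polynomial.degree_eq_natDegree hirr.ne_zero, h1'] at hpos
    exact lt_irrefl _ hpos
  · -- descend the monic factors to `L`
    have lifts : ∀ q : K[X], q.Monic → q ∣ h.map (algebraMap L K) →
        ∃ q₀ : L[X], q₀.map (algebraMap L K) = q ∧ q₀.Monic := by
      intro q hq hqd
      have hl : q ∈ Polynomial.lifts (algebraMap L K) := by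
        rw [Polynomial.lifts_iff_coeff_lifts]
        intro n
        exact hrac _ (Polynomial.isIntegral_coeff_of_dvd h q hm hq hqd n).isAlgebraic
      obtain ⟨q₀, hq₀, -, hq₀m⟩ := Polynomial.lifts_and_natDegree_eq_and_monic hl hq
      exact ⟨q₀, hq₀, hq₀m⟩
    obtain ⟨f₀, hf₀, hf₀m⟩ := lifts f hf ⟨g, hfg.symm⟩
    obtain ⟨g₀, hg₀, hg₀m⟩ := lifts g hg ⟨f, by rw [mul_comm]; exact hfg.symm⟩
    have hprod : f₀ * g₀ = h := Polynomial.map_injective _ (algebraMap L K).injective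
      (by rw [Polynomial.map_mul, hf₀, hg₀, hfg])
    rcases ((hm.irreducible_iff_natDegree).1 hirr).2 f₀ g₀ hf₀m hg₀m hprod with h0 | h0
    · left; rw [← hf₀, hf₀m.natDegree_map, h0]
    · right; rw [← hg₀, hg₀m.natDegree_map, h0]

/-! ### Base change of a simple extension -/

/-- `K ⊗ₗ L[X]/(h) ≅ K[X]/(h)`; in particular `K ⊗ₗ L[X]/(h)` is a domain as soon as `h` is prime
in `K[X]`. [folklore] -/
theorem isDomain_tensorProduct_adjoinRoot {L K : Type*} [Field L] [CommRing K] [Algebra L K]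
    {h : L[X]} (hprime : Prime (h.map (algebraMap L K))) : IsDomain (K ⊗[L] AdjoinRoot h) := by
  haveI : IsDomain (AdjoinRoot (h.map (algebraMap L K))) := AdjoinRoot.isDomain_of_prime hprime
  let e₁ : K ⊗[L] AdjoinRoot h ≃ₐ[K] (K ⊗[L] L[X]) ⧸ (Ideal.span {h}).map
      (Algebra.TensorProduct.includeRight : L[X] →ₐ[L] K ⊗[L] L[X]) :=
    Algebra.TensorProduct.tensorQuotientEquiv K L[X] K (Ideal.span {h})
  let e₂ : K ⊗[L] L[X] ≃ₐ[K] K[X] := (polyEquivTensor' L K).symm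
  have he₂ : e₂ (1 ⊗ₜ h) = h.map (algebraMap L K) := by
    have := polyEquivTensor_symm_apply_tmul_eq_smul L K (1 : K) h
    rw [one_smul] at this
    exact this
  have hJ : (Ideal.span {h.map (algebraMap L K)} : Ideal K[X]) =
      ((Ideal.span {h}).map (Algebra.TensorProduct.includeRight : L[X] →ₐ[L] K ⊗[L] L[X])).map
        (e₂ : K ⊗[L] L[X] →+* K[X]) := by
    rw [Ideal.map_span, Set.image_singleton, Ideal.map_span, Set.image_singleton, ← he₂]
    rfl
  let e₃ := Ideal.quotientEquivAlg _ _ e₂ hJ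
  exact MulEquiv.isDomain (AdjoinRoot (h.map (algebraMap L K))) (e₁.trans e₃).toMulEquiv

/-! ### Algebraic extensions -/

/-- For `L` relatively algebraically closed in `K` (characteristic `0`) and `E/L` a *finite*
extension, `E ⊗ₗ K` is a domain: `E = L(y) ≅ L[X]/(h)` by the primitive element theorem and
`h` stays irreducible over `K`. [cite: Lang2002, VIII §4] -/
theorem isDomain_tensorProduct_of_finiteDimensional {L K E : Type*} [Field L] [CharZero L]
    [Field K] [Algebra L K] [Field E] [Algebra L E] [FiniteDimensional L E]
    (hrac : ∀ z : K, IsAlgebraic L z → z ∈ Set.range (algebraMap L K)) : IsDomain (E ⊗[L] K) := by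
  haveI : Algebra.IsSeparable L E := Algebra.IsSeparable.of_integral L E
  obtain ⟨y, hy⟩ := Field.exists_primitive_element L E
  have hyi : IsIntegral L y := Algebra.IsIntegral.isIntegral y
  set h := minpoly L y with hh
  have hprime : Prime (h.map (algebraMap L K)) :=
    (irreducible_map_of_isAlgClosedIn hrac (minpoly.monic hyi) (minpoly.irreducible hyi)).prime
  haveI : IsDomain (K ⊗[L] AdjoinRoot h) := isDomain_tensorProduct_adjoinRoot hprime
  -- `E ≃ AdjoinRoot h`
  let eE : E ≃ₐ[L] AdjoinRoot h :=
    (IntermediateField.topEquiv.symm.trans (IntermediateField.equivOfEq hy.symm)).trans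
      (IntermediateField.adjoinRootEquivAdjoin L hyi).symm
  let e : E ⊗[L] K ≃ₐ[L] K ⊗[L] AdjoinRoot h :=
    (Algebra.TensorProduct.congr eE (AlgEquiv.refl : K ≃ₐ[L] K)).trans
      (Algebra.TensorProduct.comm L (AdjoinRoot h) K)
  exact MulEquiv.isDomain (K ⊗[L] AdjoinRoot h) e.toMulEquiv

/-- For `L` relatively algebraically closed in `K` (characteristic `0`) and `E/L` algebraic,
`K ⊗ₗ E` is a domain (in fact a field): two elements of `K ⊗ₗ E` live in `K ⊗ₗ E₀` for a finite
subextension `E₀`. (This is one half of "`K/L` regular iff `K` and `L^{alg}` are linearly disjoint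
over `L`", Lang VIII §4, Thm 4.12.) [cite: Lang2002, VIII §4] -/
theorem isDomain_tensorProduct_of_isAlgebraic {L K E : Type*} [Field L] [CharZero L]
    [Field K] [Algebra L K] [Field E] [Algebra L E] [Algebra.IsAlgebraic L E]
    (hrac : ∀ z : K, IsAlgebraic L z → z ∈ Set.range (algebraMap L K)) : IsDomain (K ⊗[L] E) := by
  classical
  -- work with `E ⊗ K` and reduce to finitely generated subalgebras of `E`
  haveI : IsDomain (E ⊗[L] K) := by
    haveI : Nontrivial (E ⊗[L] K) :=
      Algebra.TensorProduct.nontrivial_of_algebraMap_injective_of_isDomain L E K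
        (FaithfulSMul.algebraMap_injective L E) (FaithfulSMul.algebraMap_injective L K)
    haveI : NoZeroDivisors (E ⊗[L] K) := by
      refine noZeroDivisors_tensorProduct_of_forall_fg fun S hS => ?_
      obtain ⟨s, hs⟩ := hS
      -- `S ⊆ E₀ := L(s)`, a finite extension
      set E₀ : IntermediateField L E := IntermediateField.adjoin L (s : Set E) with hE₀
      haveI : FiniteDimensional L E₀ :=
        IntermediateField.finiteDimensional_adjoin fun x _ => Algebra.IsIntegral.isIntegral x
      have hle : S ≤ E₀.toSubalgebra := by
        rw [← hs]
        exact Algebra.adjoin_le (IntermediateField.subset_adjoin L _)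
      haveI : IsDomain (E₀ ⊗[L] K) := isDomain_tensorProduct_of_finiteDimensional hrac
      -- `S ⊗ K ↪ E₀ ⊗ K`
      let ι : S ⊗[L] K →ₐ[L] E₀ ⊗[L] K :=
        Algebra.TensorProduct.map (Subalgebra.inclusion hle) (AlgHom.id L K)
      have hι : Function.Injective ι := by
        have : (ι : S ⊗[L] K → E₀ ⊗[L] K) =
            LinearMap.rTensor K (Subalgebra.inclusion hle).toLinearMap := by
          ext z
          induction z using TensorProduct.induction_on with
          | zero => simp
          | tmul a b => simp [ι]
          | add u v hu hv => rw [map_add, map_add, hu, hv]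
        rw [this]
        exact Module.Flat.rTensor_preserves_injective_linearMap _
          (Subalgebra.inclusion_injective hle)
      exact hι.noZeroDivisors ι (map_zero ι) (map_mul ι)
    exact NoZeroDivisors.to_isDomain _
  exact MulEquiv.isDomain (E ⊗[L] K) (Algebra.TensorProduct.comm L K E).toMulEquiv

/-! ### The theorem -/

/-- Tower step, stated for an abstract intermediate field `Lb` of `Mb/L` (to keep instance paths
short): if `Lb` is algebraically closed and `Lb ⊗ₗ K` is a domain then so is
`K ⊗ₗ Mb ≅ (Lb ⊗ₗ K) ⊗_{Lb} Mb`. [folklore] -/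
theorem isDomain_tensorProduct_of_tower {L K Lb Mb : Type*} [Field L] [Field K] [Algebra L K]
    [Field Lb] [Algebra L Lb] [IsAlgClosed Lb] [Field Mb] [Algebra L Mb] [Algebra Lb Mb]
    [IsScalarTower L Lb Mb] [IsDomain (Lb ⊗[L] K)] : IsDomain (K ⊗[L] Mb) := by
  haveI : IsDomain (Mb ⊗[Lb] (Lb ⊗[L] K)) := isDomain_tensorProduct_of_isAlgClosed Lb _ Mb
  let e : Mb ⊗[Lb] (Lb ⊗[L] K) ≃ₐ[Mb] Mb ⊗[L] K :=
    Algebra.TensorProduct.cancelBaseChange L Lb Mb Mb K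
  haveI : IsDomain (Mb ⊗[L] K) := MulEquiv.isDomain (Mb ⊗[Lb] (Lb ⊗[L] K)) e.symm.toMulEquiv
  exact MulEquiv.isDomain (Mb ⊗[L] K) (Algebra.TensorProduct.comm L K Mb).toMulEquiv

/-- **Regular extensions are geometrically integral** (Lang, *Algebra* VIII §4, Thm 4.12 and
Cor. 4.14; Bourbaki, *Algèbre* V §17). Let `L ⊆ K` be fields of characteristic `0` with `L`
relatively algebraically closed in `K`. Then `K ⊗ₗ M` is an integral domain for every field
extension `M` of `L`. (Embed `M` in an algebraic closure `M̄` and let `L̄` be the algebraic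
closure of `L` in `M̄`; `K ⊗ₗ L̄` is a domain by the algebraic case, and
`K ⊗ₗ M̄ ≅ (L̄ ⊗ₗ K) ⊗_{L̄} M̄` is a tensor product of domains over the algebraically closed
field `L̄`.) [cite: Lang2002, VIII §4] -/
theorem isDomain_tensorProduct_of_isAlgClosedIn {L K M : Type*} [Field L] [CharZero L]
    [Field K] [Algebra L K] [Field M] [Algebra L M]
    (hrac : ∀ z : K, IsAlgebraic L z → z ∈ Set.range (algebraMap L K)) : IsDomain (K ⊗[L] M) := by
  classical
  -- pass to an algebraic closure `Mb` of `M` and the algebraic closure `Lb` of `L` in `Mb`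
  haveI : IsAlgClosed (algebraicClosure L (AlgebraicClosure M)) := IsAlgClosure.isAlgClosed L
  haveI : IsDomain (K ⊗[L] algebraicClosure L (AlgebraicClosure M)) :=
    isDomain_tensorProduct_of_isAlgebraic hrac
  haveI : IsDomain (algebraicClosure L (AlgebraicClosure M) ⊗[L] K) :=
    MulEquiv.isDomain (K ⊗[L] algebraicClosure L (AlgebraicClosure M))
      (Algebra.TensorProduct.comm L _ K).toMulEquiv
  haveI : IsDomain (K ⊗[L] AlgebraicClosure M) :=
    isDomain_tensorProduct_of_tower (Lb := algebraicClosure L (AlgebraicClosure M))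
  -- descend from `Mb` to `M`
  haveI : Nontrivial (K ⊗[L] M) :=
    Algebra.TensorProduct.nontrivial_of_algebraMap_injective_of_isDomain L K M
      (FaithfulSMul.algebraMap_injective L K) (FaithfulSMul.algebraMap_injective L M)
  let j : K ⊗[L] M →ₐ[K] K ⊗[L] AlgebraicClosure M :=
    Algebra.TensorProduct.map (AlgHom.id K K) (IsScalarTower.toAlgHom L M (AlgebraicClosure M))
  have hj : Function.Injective j := by
    have : (j : K ⊗[L] M → K ⊗[L] AlgebraicClosure M) =
        LinearMap.lTensor K (IsScalarTower.toAlgHom L M (AlgebraicClosure M)).toLinearMap := by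
      ext z
      induction z using TensorProduct.induction_on with
      | zero => simp
      | tmul a b => simp [j]
      | add u v hu hv => rw [map_add, map_add, hu, hv]
    rw [this]
    exact Module.Flat.lTensor_preserves_injective_linearMap _ (algebraMap M (AlgebraicClosure M)).injective
  haveI : NoZeroDivisors (K ⊗[L] M) := hj.noZeroDivisors j (map_zero j) (map_mul j)
  exact NoZeroDivisors.to_isDomain _

/-! ### Prime ideals of points stay prime under extension of scalars -/

/-- **The locus of a point over a relatively algebraically closed base is absolutely prime.**
Let `L` (characteristic `0`) be relatively algebraically closed in `K` and `β ∈ K^ι` a point, with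
prime ideal `P = I(β/L) ⊆ L[X_ι]`. Then for every homomorphism `σ : L → F'` into a field, the
extended ideal `P^σ F'[X_ι]` is prime: `F'[X_ι]/P^σ ≅ F' ⊗ₗ L[X_ι]/P ↪ F' ⊗ₗ K`, a domain.
[cite: Lang2002, VIII §4] -/
theorem isPrime_map_ker_aeval {L K F' : Type*} [Field L] [CharZero L] [Field K] [Algebra L K]
    [Field F'] (σ : L →+* F') {ι : Type*} (β : ι → K)
    (hrac : ∀ z : K, IsAlgebraic L z → z ∈ Set.range (algebraMap L K)) :
    (Ideal.map (MvPolynomial.map σ)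
      (RingHom.ker (MvPolynomial.aeval β : MvPolynomial ι L →ₐ[L] K))).IsPrime := by
  classical
  letI : Algebra L F' := σ.toAlgebra
  set P : Ideal (MvPolynomial ι L) :=
    RingHom.ker (MvPolynomial.aeval β : MvPolynomial ι L →ₐ[L] K) with hP
  -- `R = L[X]/P ↪ K`
  set R := MvPolynomial ι L ⧸ P with hR
  let q : R →ₐ[L] K := Ideal.Quotient.liftₐ P (MvPolynomial.aeval β) fun a ha => ha
  have hq : Function.Injective q := by
    rw [injective_iff_map_eq_zero]
    intro a ha
    obtain ⟨a, rfl⟩ := Ideal.Quotient.mk_surjective a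
    have ha' : MvPolynomial.aeval β a = 0 := by
      rwa [Ideal.Quotient.liftₐ_apply, Ideal.Quotient.lift_mk] at ha
    exact Ideal.Quotient.eq_zero_iff_mem.2 (RingHom.mem_ker.2 ha')
  -- `F' ⊗ R ↪ F' ⊗ K`, a domain
  haveI : IsDomain (K ⊗[L] F') := isDomain_tensorProduct_of_isAlgClosedIn hrac
  haveI : IsDomain (F' ⊗[L] K) :=
    MulEquiv.isDomain (K ⊗[L] F') (Algebra.TensorProduct.comm L F' K).toMulEquiv
  let j : F' ⊗[L] R →ₐ[F'] F' ⊗[L] K := Algebra.TensorProduct.map (AlgHom.id F' F') q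
  have hj : Function.Injective j := by
    have : (j : F' ⊗[L] R → F' ⊗[L] K) = LinearMap.lTensor F' q.toLinearMap := by
      ext z
      induction z using TensorProduct.induction_on with
      | zero => simp
      | tmul a b => simp [j]
      | add u v hu hv => rw [map_add, map_add, hu, hv]
    rw [this]
    exact Module.Flat.lTensor_preserves_injective_linearMap _ hq
  haveI : NoZeroDivisors (F' ⊗[L] R) := hj.noZeroDivisors j (map_zero j) (map_mul j)
  haveI : Nontrivial (F' ⊗[L] R) := by
    haveI : IsDomain R := (Ideal.Quotient.isDomain_iff_prime P).2 (RingHom.ker_isPrime _)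
    exact Algebra.TensorProduct.nontrivial_of_algebraMap_injective_of_isDomain L F' R
      (FaithfulSMul.algebraMap_injective L F') (FaithfulSMul.algebraMap_injective L R)
  haveI : IsDomain (F' ⊗[L] R) := NoZeroDivisors.to_isDomain _
  -- `F' ⊗ R ≅ F'[X] / P^σ`
  let e₁ : F' ⊗[L] R ≃ₐ[F'] (F' ⊗[L] MvPolynomial ι L) ⧸ P.map
      (Algebra.TensorProduct.includeRight : MvPolynomial ι L →ₐ[L] F' ⊗[L] MvPolynomial ι L) :=
    Algebra.TensorProduct.tensorQuotientEquiv F' (MvPolynomial ι L) F' P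
  let e₂ : F' ⊗[L] MvPolynomial ι L ≃ₐ[F'] MvPolynomial ι F' := MvPolynomial.algebraTensorAlgEquiv L F'
  have hJ : Ideal.map (MvPolynomial.map σ) P =
      (P.map (Algebra.TensorProduct.includeRight :
        MvPolynomial ι L →ₐ[L] F' ⊗[L] MvPolynomial ι L)).map (e₂ : _ →+* MvPolynomial ι F') := by
    rw [← Ideal.map_coe Algebra.TensorProduct.includeRight, Ideal.map_map]
    congr 1
    apply RingHom.ext
    intro p
    show MvPolynomial.map σ p = e₂ (Algebra.TensorProduct.includeRight p)
    rw [Algebra.TensorProduct.includeRight_apply, MvPolynomial.algebraTensorAlgEquiv_tmul, one_smul]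
    rfl
  let e₃ := Ideal.quotientEquivAlg _ _ e₂ hJ
  haveI : IsDomain (MvPolynomial ι F' ⧸ Ideal.map (MvPolynomial.map σ) P) :=
    MulEquiv.isDomain (F' ⊗[L] R) (e₁.trans e₃).symm.toMulEquiv
  exact (Ideal.Quotient.isDomain_iff_prime _).1 this

end Literature.FieldTheory.Regular
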